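import Literature.NumberTheory.CubicFields.CubicFieldDiscriminant431
import HarnessLib

/-!
# The cubic field of discriminant `−431`, II: the primes of norm `≤ 5` and ★ class number ONE — `2 = 𝔭_a𝔭_b𝔭_c` with `𝔭_a = (2 + θ)`, `𝔭_b = (−1 + δ)`,
# `𝔭_c = (1 + θ + δ)` principal (Dedekind's splitting), `3`, `5` inert

Sequel of `CubicFieldDiscriminant431.lean` (att-p4 g46, cell `bsd-f1-sign2`).  THEOREMS ONLY.  The Minkowski bound of `F` (`d_F = −431`, signature `(1,1)`) is
`(4/π)(6/27)√431 < 6`; the primes above `2` are the three principal primes generated by the norm-`±2` elements `2 + θ`, `−1 + δ`, `1 + θ + δ` (their product is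
`2` times the unit `−13 − 6θ`; norms by the norm form on `1, α, α²`), and `3`, `5` are inert (`f` has no root modulo `3`, `5`; Dedekind–Kummer through `θ`,
`p ∤ 2 ⊇ [𝓞_F : ℤ[θ]]`).  Hence `𝓞_F` is a PID and ★ `h_F = 1` — the datum `2 ∤ h(ℚ(β))` of the split-stratum doors of route `AlignedTransportAtTwo`.
[cite: Marcus2018, Ch. 3, Thm. 27 and Exercise 21; Ch. 5, Thm. 37 and Cor. 2] [cite: LMFDB, number field 3.1.431.1 (class number 1)]
-/

noncomputable section

open Polynomial NumberField NumberField.InfinitePlace Ideal Module Real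
open Literature.NumberTheory.NumberFields
open Literature.NumberTheory.NumberFields.MonicCubic

namespace Literature.NumberTheory.CubicFields.CubicDisc431

section NumberField

variable {F : Type*} [Field F] [NumberField F] {α : F}

/-! ## §3 The primes of norm `≤ 5` are principal -/

/-- `N(2 + θ) = -2` (norm form on `1, α, α²`; `δ = (α ^ 2 + α) / 2`). [cite: Marcus2018, Ch. 2, Thm. 4 and Exercise 13] -/
theorem natAbs_norm_piA (h3 : finrank ℚ F = 3) (hα : aeval α (poly 0 (-1) 8) = 0) :
    (Algebra.norm ℤ (2 + thetaInt hα : 𝓞 F)).natAbs = 2 := by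
  have h : ((Algebra.norm ℤ (2 + thetaInt hα : 𝓞 F) : ℤ) : ℚ) = Algebra.norm ℚ (algebraMap (𝓞 F) F (2 + thetaInt hα)) :=
    Algebra.coe_norm_int _
  have hx : algebraMap (𝓞 F) F (2 + thetaInt hα) = ((2 : ℚ) : F) + ((1 : ℚ) : F) * α + ((0 : ℚ) : F) * α ^ 2 := by
    simp only [map_add, map_ofNat, MonicCubic.thetaInt, RingOfIntegers.map_mk]
    push_cast; ring
  rw [hx, norm_lin irreducible_polyQ hα h3] at h
  have hn : normForm 0 (-1) 8 (2) (1) (0) = ((-2 : ℤ) : ℚ) := by norm_num [normForm]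
  rw [hn] at h
  have h' : Algebra.norm ℤ (2 + thetaInt hα : 𝓞 F) = -2 := by exact_mod_cast h
  rw [h']; rfl

/-- `2 + θ` is a prime element of `𝓞_F` (norm `-2`). [cite: Marcus2018, Ch. 3, Thm. 27] -/
theorem prime_piA (h3 : finrank ℚ F = 3) (hα : aeval α (poly 0 (-1) 8) = 0) : Prime (2 + thetaInt hα : 𝓞 F) :=
  prime_of_natAbs_norm_prime (by rw [natAbs_norm_piA h3 hα]; norm_num)

/-- `N(-1 + δ) = 2` (norm form on `1, α, α²`; `δ = (α ^ 2 + α) / 2`). [cite: Marcus2018, Ch. 2, Thm. 4 and Exercise 13] -/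
theorem natAbs_norm_piB (h3 : finrank ℚ F = 3) (hα : aeval α (poly 0 (-1) 8) = 0) :
    (Algebra.norm ℤ (-1 + thetaInt (delta_root hα) : 𝓞 F)).natAbs = 2 := by
  have h : ((Algebra.norm ℤ (-1 + thetaInt (delta_root hα) : 𝓞 F) : ℤ) : ℚ) = Algebra.norm ℚ (algebraMap (𝓞 F) F (-1 + thetaInt (delta_root hα))) :=
    Algebra.coe_norm_int _
  have hx : algebraMap (𝓞 F) F (-1 + thetaInt (delta_root hα)) = ((-1 : ℚ) : F) + ((1/2 : ℚ) : F) * α + ((1/2 : ℚ) : F) * α ^ 2 := by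
    simp only [map_add, map_neg, map_one, MonicCubic.thetaInt, RingOfIntegers.map_mk]
    push_cast; ring
  rw [hx, norm_lin irreducible_polyQ hα h3] at h
  have hn : normForm 0 (-1) 8 (-1) (1/2) (1/2) = ((2 : ℤ) : ℚ) := by norm_num [normForm]
  rw [hn] at h
  have h' : Algebra.norm ℤ (-1 + thetaInt (delta_root hα) : 𝓞 F) = 2 := by exact_mod_cast h
  rw [h']; rfl

/-- `-1 + δ` is a prime element of `𝓞_F` (norm `2`). [cite: Marcus2018, Ch. 3, Thm. 27] -/
theorem prime_piB (h3 : finrank ℚ F = 3) (hα : aeval α (poly 0 (-1) 8) = 0) : Prime (-1 + thetaInt (delta_root hα) : 𝓞 F) :=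
  prime_of_natAbs_norm_prime (by rw [natAbs_norm_piB h3 hα]; norm_num)

/-- `N(1 + θ + δ) = 2` (norm form on `1, α, α²`; `δ = (α ^ 2 + α) / 2`). [cite: Marcus2018, Ch. 2, Thm. 4 and Exercise 13] -/
theorem natAbs_norm_piC (h3 : finrank ℚ F = 3) (hα : aeval α (poly 0 (-1) 8) = 0) :
    (Algebra.norm ℤ (1 + thetaInt hα + thetaInt (delta_root hα) : 𝓞 F)).natAbs = 2 := by
  have h : ((Algebra.norm ℤ (1 + thetaInt hα + thetaInt (delta_root hα) : 𝓞 F) : ℤ) : ℚ) = Algebra.norm ℚ (algebraMap (𝓞 F) F (1 + thetaInt hα + thetaInt (delta_root hα))) :=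
    Algebra.coe_norm_int _
  have hx : algebraMap (𝓞 F) F (1 + thetaInt hα + thetaInt (delta_root hα)) = ((1 : ℚ) : F) + ((3/2 : ℚ) : F) * α + ((1/2 : ℚ) : F) * α ^ 2 := by
    simp only [map_add, map_one, MonicCubic.thetaInt, RingOfIntegers.map_mk]
    push_cast; ring
  rw [hx, norm_lin irreducible_polyQ hα h3] at h
  have hn : normForm 0 (-1) 8 (1) (3/2) (1/2) = ((2 : ℤ) : ℚ) := by norm_num [normForm]
  rw [hn] at h
  have h' : Algebra.norm ℤ (1 + thetaInt hα + thetaInt (delta_root hα) : 𝓞 F) = 2 := by exact_mod_cast h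
  rw [h']; rfl

/-- `1 + θ + δ` is a prime element of `𝓞_F` (norm `2`). [cite: Marcus2018, Ch. 3, Thm. 27] -/
theorem prime_piC (h3 : finrank ℚ F = 3) (hα : aeval α (poly 0 (-1) 8) = 0) : Prime (1 + thetaInt hα + thetaInt (delta_root hα) : 𝓞 F) :=
  prime_of_natAbs_norm_prime (by rw [natAbs_norm_piC h3 hα]; norm_num)

/-- **`2` splits completely**: `(2 + θ)·(-1 + δ)·(1 + θ + δ) = (-13 - 6 * θ)·2` (the cofactor is a unit). [cite: Marcus2018, Ch. 3, Thm. 27 and Exercise 21 (Dedekind)] -/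
theorem prod_dyadic_eq (hα : aeval α (poly 0 (-1) 8) = 0) :
    (2 + thetaInt hα : 𝓞 F) * (-1 + thetaInt (delta_root hα)) * (1 + thetaInt hα + thetaInt (delta_root hα)) = (-13 - 6 * thetaInt hα) * (((2 : ℕ) : ℤ) : 𝓞 F) := by
  rw [RingOfIntegers.ext_iff]
  simp only [map_mul, map_add, map_sub, map_neg, map_ofNat, map_one, map_intCast, MonicCubic.thetaInt, RingOfIntegers.map_mk]
  push_cast
  linear_combination (((3 : F)) + ((3 : F) / 2) * α + ((1 : F) / 4) * α ^ 2) * cubic_eq hα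

/-- **Every prime of `𝓞_F` above `2` is principal**: `2` is the product of the three prime elements above (up to a unit), so a prime `P ∋ 2` is one of
the three principal primes `(π)`. [cite: Marcus2018, Ch. 3, Thm. 27 and Exercise 21] [cite: LMFDB, number field 3.1.431.1 (class number 1)] -/
theorem isPrincipal_of_mem_primesOver_2 (h3 : finrank ℚ F = 3) (hα : aeval α (poly 0 (-1) 8) = 0) {P : Ideal (𝓞 F)}
    (hP : P ∈ primesOver (span {((2 : ℕ) : ℤ)}) (𝓞 F)) : Submodule.IsPrincipal P := by
  haveI := hP.1
  have h2 : (((2 : ℕ) : ℤ) : 𝓞 F) ∈ P := by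
    have hu : ((2 : ℕ) : ℤ) ∈ P.under ℤ := by
      rw [← hP.2.over]; exact Ideal.mem_span_singleton_self _
    exact hu
  have hmem : (2 + thetaInt hα : 𝓞 F) * (-1 + thetaInt (delta_root hα)) * (1 + thetaInt hα + thetaInt (delta_root hα)) ∈ P := by
    rw [prod_dyadic_eq hα]; exact P.mul_mem_left _ h2
  rcases eq_span_singleton_of_prod_mem hP.1 (prime_piA h3 hα) (prime_piB h3 hα) (prime_piC h3 hα) hmem with h | h | h
  · exact ⟨⟨_, by rw [h, Ideal.submodule_span_eq]⟩⟩
  · exact ⟨⟨_, by rw [h, Ideal.submodule_span_eq]⟩⟩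
  · exact ⟨⟨_, by rw [h, Ideal.submodule_span_eq]⟩⟩

/-- **Every prime of `𝓞_F` above `3` is principal**: `3` is inert (`f` irreducible mod `3`, `3 ∤ exponent`), so `P = (3)`.
[cite: Marcus2018, Ch. 3, Thm. 27] [cite: LMFDB, number field 3.1.431.1 (class number 1)] -/
theorem isPrincipal_of_mem_primesOver_3 (h3 : finrank ℚ F = 3) (hα : aeval α (poly 0 (-1) 8) = 0) {P : Ideal (𝓞 F)}
    (hP : P ∈ primesOver (span {((3 : ℕ) : ℤ)}) (𝓞 F)) : Submodule.IsPrincipal P := by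
  have hPeq := eq_span_of_no_root' irreducible_polyQ hα (by norm_num : Nat.Prime 3)
    (not_dvd_exponent h3 hα (by norm_num) (by norm_num)) hP no_root_3
  exact ⟨⟨((3 : ℕ) : 𝓞 F), by rw [hPeq, Ideal.submodule_span_eq]⟩⟩

/-- `f` has no root modulo `5`. [cite: Marcus2018, Ch. 3, Thm. 27] -/
theorem no_root_5' :
    ∀ r : ZMod 5, r ^ 3 + ((0 : ℤ) : ZMod 5) * r ^ 2 + ((-1 : ℤ) : ZMod 5) * r + ((8 : ℤ) : ZMod 5) ≠ 0 := by
  decide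

/-- **Every prime of `𝓞_F` above `5` is principal**: `5` is inert (`f` irreducible mod `5`, `5 ∤ exponent`), so `P = (5)`.
[cite: Marcus2018, Ch. 3, Thm. 27] [cite: LMFDB, number field 3.1.431.1 (class number 1)] -/
theorem isPrincipal_of_mem_primesOver_5 (h3 : finrank ℚ F = 3) (hα : aeval α (poly 0 (-1) 8) = 0) {P : Ideal (𝓞 F)}
    (hP : P ∈ primesOver (span {((5 : ℕ) : ℤ)}) (𝓞 F)) : Submodule.IsPrincipal P := by
  have hPeq := eq_span_of_no_root' irreducible_polyQ hα (by norm_num : Nat.Prime 5)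
    (not_dvd_exponent h3 hα (by norm_num) (by norm_num)) hP no_root_5'
  exact ⟨⟨((5 : ℕ) : 𝓞 F), by rw [hPeq, Ideal.submodule_span_eq]⟩⟩

/-! ## §4 Class number one -/

/-- **`𝓞_F` is a principal ideal domain.**  Minkowski: every ideal class contains an ideal of norm `≤ (4/π)(6/27)√431 < 6`, and the primes
`P` above `p ≤ 5` with `p^f ≤ 5` are principal (§3). [cite: LMFDB, number field 3.1.431.1 (class number 1)] [cite: Marcus2018, Ch. 5, Thm. 37 and Cor. 2] -/
theorem isPrincipalIdealRing (h3 : finrank ℚ F = 3) (hα : aeval α (poly 0 (-1) 8) = 0) : IsPrincipalIdealRing (𝓞 F) := by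
  apply RingOfIntegers.isPrincipalIdealRing_of_isPrincipal_of_pow_le_of_mem_primesOver_of_mem_Icc
  rw [nrComplexPlaces_eq_one h3 hα, h3, discr_eq h3 hα]
  intro p hp hpr P hP hle
  obtain ⟨hp1, hpM⟩ := Finset.mem_Icc.mp hp
  have hreal : (4 / π) ^ 1 * ((((3 : ℕ).factorial : ℕ) : ℝ) / ((3 : ℕ) : ℝ) ^ (3 : ℕ) * √|((-431 : ℤ) : ℝ)|) < ((6 : ℕ) : ℝ) := by
    have hπ := Real.pi_gt_d2
    have hπ0 := Real.pi_pos
    have hs : √(431 : ℝ) < 20.77 := by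
      rw [Real.sqrt_lt' (by norm_num)]; norm_num
    have hs0 : 0 ≤ √(431 : ℝ) := Real.sqrt_nonneg _
    have habs : |((-431 : ℤ) : ℝ)| = 431 := by norm_num
    rw [habs]
    norm_num [Nat.factorial]
    rw [div_mul_eq_mul_div, div_lt_iff₀ hπ0]
    nlinarith
  have hfl := Nat.lt_succ_iff.mp ((Nat.floor_lt' (by norm_num)).mpr hreal)
  have hpB : p ≤ 5 := hpM.trans hfl
  have hleB : p ^ P.inertiaDeg ℤ ≤ 5 := hle.trans hfl
  clear hpM hle hp
  interval_cases p
  · exact absurd hpr (by norm_num)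
  · exact isPrincipal_of_mem_primesOver_2 h3 hα hP
  · exact isPrincipal_of_mem_primesOver_3 h3 hα hP
  · exact absurd hpr (by norm_num)
  · exact isPrincipal_of_mem_primesOver_5 h3 hα hP

/-- ★ **`h_F = 1`: the cubic field of discriminant `−431` has class number one** (`𝓞_F = ℤ ⊕ ℤθ ⊕ ℤδ`, no power integral basis found).
[cite: LMFDB, number field 3.1.431.1 (class number 1)] -/
theorem classNumber_eq_one (h3 : finrank ℚ F = 3) (hα : aeval α (poly 0 (-1) 8) = 0) : classNumber F = 1 :=
  (classNumber_eq_one_iff (K := F)).mpr (isPrincipalIdealRing h3 hα)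

/-- **`h_F` is odd** (the form consumed by the `2`-adic doors of cell `bsd-f1-sign2`). [cite: LMFDB, number field 3.1.431.1 (class number 1)] -/
theorem not_two_dvd_classNumber (h3 : finrank ℚ F = 3) (hα : aeval α (poly 0 (-1) 8) = 0) : ¬ 2 ∣ classNumber F := by
  rw [classNumber_eq_one h3 hα]; decide

end NumberField

end Literature.NumberTheory.CubicFields.CubicDisc431

end
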